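import Literature.Probability.RandomPlanarGeometry.HexSAWStripWidthTwoContactRecursion
import HarnessLib

/-!
# The width-two strip: the characteristic polynomial `det(λ − G₂(y)) = λ⁴ − x²(1+y)λ³ + x⁴yλ² − x⁶yλ` annihilates the hat bridge sums for EVERY `y`,
# and its `y∂_y` derivatives drive the contact sums `Ĉ`, `Ĉ²`, `Ĉ³` (module «WIDTH-TWO HAT CONTACT ANNIHILATOR»)

Topic `Literature/Probability/RandomPlanarGeometry` (continues «WIDTH-TWO HAT RECURSION» `HexSAWStripWidthTwoHatRecursion.lean` — `W2.gTwo y` (the one-step matrix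
`G₂(y)`), `W2.hatD_two_succ : D̂(k+1) = G₂D̂(k)` (`k ≥ 1`, every `y ≥ 0`) —, «WIDTH-TWO CONTACT RECURSION» (`W2.hatCD`, `W2.hatC2D`) and the `y∂_y` plumbing of
«CONTACT-DENSITY»/«CONTACT-LLN» (`HV.hasDerivAt_LUs`, `HV.mul_derivSum_eq_contactSum`, `HV.hasDerivAt_contactSum`, `HV.mul_derivContactSum_eq`)).  Lane «pcv-sawmu»
(CriticalPhenomena venture), a-p2 g29 — the width-TWO instance of the det-P device of «WIDTH-THREE HAT CONTACT ANNIHILATOR»: Cayley–Hamilton for the explicit `4 × 4`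
matrix `G₂(y)` gives the scalar order-`4` recurrence `Σ_r t_r(y)D̂(n+1+r) = 0` with `t₄ = 1`, `t₃ = −x²(1+y)`, `t₂ = x⁴y`, `t₁ = −x⁶y` — LINEAR in `y`, so
`ṫ_r := y∂_y t_r` has `ṫ₃ = −x²y`, `ṫ₂ = x⁴y`, `ṫ₁ = −x⁶y` and `(y∂_y)²t_r = (y∂_y)³t_r = ṫ_r`; differentiating the recurrence once, twice, thrice (uniqueness of the
derivative on `(0, ∞)`) gives the contact annihilators with binomial weights `1,1 / 1,2,1 / 1,3,3,1`.  Purpose: the THIRD contact cumulant of `S₂`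
(`κ₃(T=2) = (13836 − 9785√2)/16`, next module), by the same route that gave `σ₃²`, `κ₃` at `T = 3`.  Frame: W. Feller I (1968) XIII.6; nothing below is printed.

## What is proved (namespace `…SAW.HV.W2`; `x = x_c`, `G = gTwo y`)
* §1 (Cayley–Hamilton `gTwo_cayleyHamilton` of «WIDTH-TWO HAT RECURSION» is used as is); `detYTwo`, `detYTwoDot` (the coefficients and their `y∂_y`);
  ★★ `detYTwo_annihilator : Σ_{r<5} t_r(y)·D̂(n+1+r)_{ab} = 0` (`y ≥ 0`).
* §2 `hatC3DTwo` (`Σ #top³·wD`), derivative plumbing (`hasDerivAt_detYTwo`, `hasDerivAt_detYTwoDot`, `hasDerivAt_contactSqSum_two`, `mul_derivContactSqSum_two_eq`).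
* §3 ★★★ `detYTwo_contact_annihilator` (`Σ tĈ + Σ ṫD̂ = 0`), `detYTwo_contact_sq_annihilator` (`Σ tĈ² + 2Σ ṫĈ + Σ ṫD̂ = 0`),
  `detYTwo_contact_cube_annihilator` (`Σ tĈ³ + 3Σ ṫĈ² + 3Σ ṫĈ + Σ ṫD̂ = 0`), all for `y > 0`.
* §4 plumbing (private `succ_add_pow_mul_pow_le_two`), `abs_sum_mul_shift_le_five` (the `range 5` twin of the width-three lemma).

Label: LANE THEOREM (own result of lane «pcv-sawmu», a-p2 g29, 2026-08-28; not in print).  NOT claimed: the moment laws and `κ₃(T = 2)` (next module).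
-/

noncomputable section

open Finset Filter Topology Matrix Literature.Probability.LatticeModels Literature.Probability.Percolation

namespace Literature.Probability.RandomPlanarGeometry.SAW

namespace HV

namespace W2

/-! ## §1 The coefficients of `det(λ − G₂(y))` and the scalar annihilator -/

/-- The coefficients `t_r(y)` of `det(λ − G₂(y))`: `t₄ = 1`, `t₃ = −x²(1+y)`, `t₂ = x⁴y`, `t₁ = −x⁶y`, else `0`. [cite: Stanley2012EC1, §4.1; lane «pcv-sawmu» a-p2 g29] -/
def detYTwo (y : ℝ) : ℕ → ℝ
  | 1 => -(hexCriticalFugacity ^ 6 * y)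
  | 2 => hexCriticalFugacity ^ 4 * y
  | 3 => -(hexCriticalFugacity ^ 2 * (1 + y))
  | 4 => 1
  | _ => 0

/-- `ṫ_r(y) = y∂_y t_r(y)`: `ṫ₃ = −x²y`, `ṫ₂ = x⁴y`, `ṫ₁ = −x⁶y`, else `0` (the coefficients are linear in `y`, so all higher `y∂_y`-derivatives equal `ṫ_r` too).
[cite: Feller1968, XIII.6; lane «pcv-sawmu» a-p2 g29] -/
def detYTwoDot (y : ℝ) : ℕ → ℝ
  | 1 => -(hexCriticalFugacity ^ 6 * y)
  | 2 => hexCriticalFugacity ^ 4 * y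
  | 3 => -(hexCriticalFugacity ^ 2 * y)
  | _ => 0

/-- ★★ **The scalar annihilator of the width-two hat bridge sums, for every `y ≥ 0`**: `Σ_{r<5} t_r(y)·D̂(n+1+r)_{ab} = 0`
(`D̂(n+1+r) = G^r D̂(n+1)` and Cayley–Hamilton). [cite: Stanley2012EC1, §4.1 Theorem 4.1.1 (iii); lane «pcv-sawmu» a-p2 g29 — own result] -/
theorem detYTwo_annihilator {y : ℝ} (hy : 0 ≤ y) (a b : Fin (2 * 2)) (n : ℕ) :
    ∑ r ∈ range 5, detYTwo y r * hatD 2 y (n + 1 + r) a b = 0 := by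
  have h1 : hatD 2 y (n + 1 + 1) = gTwo y * hatD 2 y (n + 1) := hatD_two_succ hy (by omega)
  have h2 : hatD 2 y (n + 1 + 2) = gTwo y ^ 2 * hatD 2 y (n + 1) := by
    rw [show n + 1 + 2 = n + 1 + 1 + 1 by ring, hatD_two_succ hy (by omega), h1, ← Matrix.mul_assoc, pow_two]
  have h3 : hatD 2 y (n + 1 + 3) = gTwo y ^ 3 * hatD 2 y (n + 1) := by
    rw [show n + 1 + 3 = n + 1 + 2 + 1 by ring, hatD_two_succ hy (by omega), h2, ← Matrix.mul_assoc, ← pow_succ']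
  have h4 : hatD 2 y (n + 1 + 4) = gTwo y ^ 4 * hatD 2 y (n + 1) := by
    rw [show n + 1 + 4 = n + 1 + 3 + 1 by ring, hatD_two_succ hy (by omega), h3, ← Matrix.mul_assoc, ← pow_succ']
  have hM : (gTwo y ^ 4 - (hexCriticalFugacity ^ 2 * (1 + y)) • gTwo y ^ 3 + (hexCriticalFugacity ^ 4 * y) • gTwo y ^ 2
      - (hexCriticalFugacity ^ 6 * y) • gTwo y) * hatD 2 y (n + 1) = 0 := by rw [gTwo_cayleyHamilton, Matrix.zero_mul]
  have hab := congr_fun (congr_fun hM a) b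
  simp only [Matrix.sub_mul, Matrix.add_mul, Matrix.smul_mul, ← h1, ← h2, ← h3, ← h4, Matrix.sub_apply, Matrix.add_apply, Matrix.smul_apply,
    smul_eq_mul, Matrix.zero_apply] at hab
  simp only [Finset.sum_range_succ, Finset.sum_range_zero, detYTwo, zero_mul, zero_add, show n + 1 + 0 = n + 1 by ring]
  linear_combination hab

/-! ## §2 The cube-weighted contact sums and derivative plumbing -/

/-- The cube-weighted contact hat bridge sum of `S₂`: `Ĉ³(k)_{ab} = Σ #top³·x^{#steps}y^{#top}`. [cite: Feller1968, XIII.6; DuminilCopinHammond2013, §2.2; lane «pcv-sawmu» a-p2 g29] -/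
def hatC3DTwo (y : ℝ) (k : ℕ) : Matrix (Fin (2 * 2)) (Fin (2 * 2)) ℝ :=
  Matrix.of fun a b : Fin (2 * 2) => ∑ l ∈ LUset 2 (2 * k + 1) (hatLen k a b) (a : ℕ) (b : ℕ), (topCnt 2 l.tail : ℝ) ^ 3 * wD 2 y l

/-- `k·y^{k−1}·y = k·y^k` (plumbing, private). [folklore] -/
private theorem natMul_pow_pred_mul_w2 (k : ℕ) (y : ℝ) : (k : ℝ) * y ^ (k - 1) * y = (k : ℝ) * y ^ k := by
  rcases Nat.eq_zero_or_pos k with h | h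
  · subst h; simp
  · rw [mul_assoc, ← pow_succ, Nat.sub_add_cancel h]

/-- The square-weighted contact sum over a finite set of words is differentiable in `y` (plumbing). [cite: DuminilCopinHammond2013, §2.2; lane plumbing] -/
theorem hasDerivAt_contactSqSum_two (S : Finset (List HV)) (y : ℝ) :
    HasDerivAt (fun y => ∑ l ∈ S, (topCnt 2 l.tail : ℝ) ^ 2 * wD 2 y l)
      (∑ l ∈ S, (topCnt 2 l.tail : ℝ) ^ 2 * (hexCriticalFugacity ^ (l.length - 1) * ((topCnt 2 l.tail : ℝ) * y ^ (topCnt 2 l.tail - 1)))) y := by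
  unfold wD
  exact HasDerivAt.fun_sum fun l _ => ((hasDerivAt_pow _ y).const_mul _).const_mul _

/-- `y · ∂_y Σ #top²·wD = Σ #top³·wD` (plumbing). [cite: DuminilCopinHammond2013, §2.2; lane plumbing] -/
theorem mul_derivContactSqSum_two_eq (S : Finset (List HV)) (y : ℝ) :
    y * ∑ l ∈ S, (topCnt 2 l.tail : ℝ) ^ 2 * (hexCriticalFugacity ^ (l.length - 1) * ((topCnt 2 l.tail : ℝ) * y ^ (topCnt 2 l.tail - 1))) =
      ∑ l ∈ S, (topCnt 2 l.tail : ℝ) ^ 3 * wD 2 y l := by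
  rw [mul_sum]
  refine sum_congr rfl fun l _ => ?_
  unfold wD
  calc y * ((topCnt 2 l.tail : ℝ) ^ 2 * (hexCriticalFugacity ^ (l.length - 1) * ((topCnt 2 l.tail : ℝ) * y ^ (topCnt 2 l.tail - 1))))
      = (topCnt 2 l.tail : ℝ) ^ 2 * hexCriticalFugacity ^ (l.length - 1) * ((topCnt 2 l.tail : ℝ) * y ^ (topCnt 2 l.tail - 1) * y) := by ring
    _ = _ := by rw [natMul_pow_pred_mul_w2]; ring

/-- `t_r` is differentiable in `y` with `y·t_r′ = ṫ_r` (plumbing). [cite: Feller1968, XIII.6; lane plumbing] -/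
theorem hasDerivAt_detYTwo (y : ℝ) (r : ℕ) : ∃ d : ℝ, HasDerivAt (fun y => detYTwo y r) d y ∧ y * d = detYTwoDot y r := by
  rcases r with _ | _ | _ | _ | _ | r
  · exact ⟨0, by simpa [detYTwo] using hasDerivAt_const y (0 : ℝ), by simp [detYTwoDot]⟩
  · refine ⟨-(hexCriticalFugacity ^ 6), ?_, by simp [detYTwoDot]; ring⟩
    simpa [detYTwo, neg_mul] using (hasDerivAt_id y).const_mul (-(hexCriticalFugacity ^ 6))
  · refine ⟨hexCriticalFugacity ^ 4, ?_, by simp [detYTwoDot]; ring⟩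
    simpa [detYTwo] using (hasDerivAt_id y).const_mul (hexCriticalFugacity ^ 4)
  · refine ⟨-(hexCriticalFugacity ^ 2), ?_, by simp [detYTwoDot]; ring⟩
    have h : HasDerivAt (fun y : ℝ => -(hexCriticalFugacity ^ 2) * (1 + y)) (-(hexCriticalFugacity ^ 2) * 1) y :=
      ((hasDerivAt_id y).const_add 1).const_mul (-(hexCriticalFugacity ^ 2))
    simpa [detYTwo, neg_mul] using h
  · exact ⟨0, by simpa [detYTwo] using hasDerivAt_const y (1 : ℝ), by simp [detYTwoDot]⟩
  · exact ⟨0, by simpa [detYTwo] using hasDerivAt_const y (0 : ℝ), by simp [detYTwoDot]⟩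

/-- `ṫ_r` is differentiable in `y` with `y·ṫ_r′ = ṫ_r` (the coefficients are linear in `y`; plumbing). [cite: Feller1968, XIII.6; lane plumbing] -/
theorem hasDerivAt_detYTwoDot (y : ℝ) (r : ℕ) : ∃ d : ℝ, HasDerivAt (fun y => detYTwoDot y r) d y ∧ y * d = detYTwoDot y r := by
  rcases r with _ | _ | _ | _ | r
  · exact ⟨0, by simpa [detYTwoDot] using hasDerivAt_const y (0 : ℝ), by simp [detYTwoDot]⟩
  · refine ⟨-(hexCriticalFugacity ^ 6), ?_, by simp [detYTwoDot]; ring⟩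
    simpa [detYTwoDot, neg_mul] using (hasDerivAt_id y).const_mul (-(hexCriticalFugacity ^ 6))
  · refine ⟨hexCriticalFugacity ^ 4, ?_, by simp [detYTwoDot]; ring⟩
    simpa [detYTwoDot] using (hasDerivAt_id y).const_mul (hexCriticalFugacity ^ 4)
  · refine ⟨-(hexCriticalFugacity ^ 2), ?_, by simp [detYTwoDot]; ring⟩
    simpa [detYTwoDot, neg_mul] using (hasDerivAt_id y).const_mul (-(hexCriticalFugacity ^ 2))
  · exact ⟨0, by simpa [detYTwoDot] using hasDerivAt_const y (0 : ℝ), by simp [detYTwoDot]⟩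

/-! ## §3 The three contact annihilators -/

/-- ★★★ **First contact annihilator of `S₂`**: `Σ_{r<5} t_r(y)Ĉ(n+1+r)_{ab} + Σ_{r<5} ṫ_r(y)D̂(n+1+r)_{ab} = 0` (`y > 0`; `y∂_y` of `detYTwo_annihilator`).
[cite: Feller1968, XIII.6; Stanley2012EC1, §4.1 Theorem 4.1.1 (iii); lane «pcv-sawmu» a-p2 g29 — own result] -/
theorem detYTwo_contact_annihilator {y : ℝ} (hy : 0 < y) (a b : Fin (2 * 2)) (n : ℕ) :
    ∑ r ∈ range 5, detYTwo y r * hatCD y (n + 1 + r) a b + ∑ r ∈ range 5, detYTwoDot y r * hatD 2 y (n + 1 + r) a b = 0 := by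
  set dU : ℕ → ℝ → ℝ := fun k y =>
    ∑ l ∈ LUset 2 (2 * k + 1) (hatLen k a b) (a : ℕ) (b : ℕ), hexCriticalFugacity ^ (l.length - 1) * ((topCnt 2 l.tail : ℝ) * y ^ (topCnt 2 l.tail - 1))
    with hdU
  have hD : ∀ k (y : ℝ), HasDerivAt (fun y => hatD 2 y k a b) (dU k y) y := fun k y => hasDerivAt_LUs (2 * k + 1) (hatLen k a b) _ _ y
  have hU : ∀ k, y * dU k y = hatCD y k a b := fun k => by
    rw [hdU]; simp only [hatCD, Matrix.of_apply]; exact mul_derivSum_eq_contactSum _ y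
  choose dT hdT hTdot using fun r => hasDerivAt_detYTwo y r
  set F : ℝ → ℝ := fun y => ∑ r ∈ range 5, detYTwo y r * hatD 2 y (n + 1 + r) a b with hF
  have hFd : HasDerivAt F (∑ r ∈ range 5, (dT r * hatD 2 y (n + 1 + r) a b + detYTwo y r * dU (n + 1 + r) y)) y := by
    rw [hF]; exact HasDerivAt.fun_sum fun r _ => (hdT r).mul (hD (n + 1 + r) y)
  have hF0 : F =ᶠ[𝓝 y] fun _ => (0 : ℝ) := by
    filter_upwards [Ioi_mem_nhds hy] with y' hy'
    rw [hF]; exact detYTwo_annihilator (le_of_lt hy') a b n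
  have hzero := (hFd.congr_of_eventuallyEq hF0.symm).unique (hasDerivAt_const y (0 : ℝ))
  have hmul : y * ∑ r ∈ range 5, (dT r * hatD 2 y (n + 1 + r) a b + detYTwo y r * dU (n + 1 + r) y)
      = ∑ r ∈ range 5, detYTwo y r * hatCD y (n + 1 + r) a b + ∑ r ∈ range 5, detYTwoDot y r * hatD 2 y (n + 1 + r) a b := by
    rw [Finset.mul_sum, ← Finset.sum_add_distrib]
    refine Finset.sum_congr rfl fun r _ => ?_
    rw [← hU (n + 1 + r), ← hTdot r]; ring
  rw [← hmul, hzero, mul_zero]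

/-- ★★★ **Second contact annihilator of `S₂`**: `Σ t_rĈ²(n+1+r) + 2Σ ṫ_rĈ(n+1+r) + Σ ṫ_rD̂(n+1+r) = 0` (`y > 0`; note `(y∂_y)²t_r = ṫ_r`).
[cite: Feller1968, XIII.6; lane «pcv-sawmu» a-p2 g29 — own result] -/
theorem detYTwo_contact_sq_annihilator {y : ℝ} (hy : 0 < y) (a b : Fin (2 * 2)) (n : ℕ) :
    ∑ r ∈ range 5, detYTwo y r * hatC2D y (n + 1 + r) a b + 2 * ∑ r ∈ range 5, detYTwoDot y r * hatCD y (n + 1 + r) a b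
      + ∑ r ∈ range 5, detYTwoDot y r * hatD 2 y (n + 1 + r) a b = 0 := by
  set dU : ℕ → ℝ → ℝ := fun k y =>
    ∑ l ∈ LUset 2 (2 * k + 1) (hatLen k a b) (a : ℕ) (b : ℕ), hexCriticalFugacity ^ (l.length - 1) * ((topCnt 2 l.tail : ℝ) * y ^ (topCnt 2 l.tail - 1))
    with hdU
  set dC : ℕ → ℝ → ℝ := fun k y =>
    ∑ l ∈ LUset 2 (2 * k + 1) (hatLen k a b) (a : ℕ) (b : ℕ),
      (topCnt 2 l.tail : ℝ) * (hexCriticalFugacity ^ (l.length - 1) * ((topCnt 2 l.tail : ℝ) * y ^ (topCnt 2 l.tail - 1))) with hdC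
  have hD : ∀ k (y : ℝ), HasDerivAt (fun y => hatD 2 y k a b) (dU k y) y := fun k y => hasDerivAt_LUs (2 * k + 1) (hatLen k a b) _ _ y
  have hC : ∀ k (y : ℝ), HasDerivAt (fun y => hatCD y k a b) (dC k y) y := fun k y => by
    simp only [hatCD, Matrix.of_apply]; exact hasDerivAt_contactSum _ y
  have hU : ∀ k, y * dU k y = hatCD y k a b := fun k => by
    rw [hdU]; simp only [hatCD, Matrix.of_apply]; exact mul_derivSum_eq_contactSum _ y
  have hC2 : ∀ k, y * dC k y = hatC2D y k a b := fun k => by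
    rw [hdC]; simp only [hatC2D, Matrix.of_apply]; exact mul_derivContactSum_eq _ y
  choose dT hdT hTdot using fun r => hasDerivAt_detYTwo y r
  choose dTd hdTd hTddot using fun r => hasDerivAt_detYTwoDot y r
  have hdd : ∀ r, dTd r = dT r := fun r => mul_left_cancel₀ hy.ne' ((hTddot r).trans (hTdot r).symm)
  set F : ℝ → ℝ := fun y => ∑ r ∈ range 5, detYTwo y r * hatCD y (n + 1 + r) a b + ∑ r ∈ range 5, detYTwoDot y r * hatD 2 y (n + 1 + r) a b with hF
  have hFd : HasDerivAt F (∑ r ∈ range 5, (dT r * hatCD y (n + 1 + r) a b + detYTwo y r * dC (n + 1 + r) y)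
      + ∑ r ∈ range 5, (dTd r * hatD 2 y (n + 1 + r) a b + detYTwoDot y r * dU (n + 1 + r) y)) y := by
    rw [hF]
    exact (HasDerivAt.fun_sum fun r _ => (hdT r).mul (hC (n + 1 + r) y)).add (HasDerivAt.fun_sum fun r _ => (hdTd r).mul (hD (n + 1 + r) y))
  have hF0 : F =ᶠ[𝓝 y] fun _ => (0 : ℝ) := by
    filter_upwards [Ioi_mem_nhds hy] with y' hy'
    rw [hF]; exact detYTwo_contact_annihilator hy' a b n
  have hzero := (hFd.congr_of_eventuallyEq hF0.symm).unique (hasDerivAt_const y (0 : ℝ))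
  have hmul : y * (∑ r ∈ range 5, (dT r * hatCD y (n + 1 + r) a b + detYTwo y r * dC (n + 1 + r) y)
      + ∑ r ∈ range 5, (dTd r * hatD 2 y (n + 1 + r) a b + detYTwoDot y r * dU (n + 1 + r) y))
      = ∑ r ∈ range 5, detYTwo y r * hatC2D y (n + 1 + r) a b + 2 * ∑ r ∈ range 5, detYTwoDot y r * hatCD y (n + 1 + r) a b
        + ∑ r ∈ range 5, detYTwoDot y r * hatD 2 y (n + 1 + r) a b := by
    rw [mul_add, Finset.mul_sum, Finset.mul_sum, Finset.mul_sum, ← Finset.sum_add_distrib, ← Finset.sum_add_distrib, ← Finset.sum_add_distrib]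
    refine Finset.sum_congr rfl fun r _ => ?_
    rw [hdd r, ← hU (n + 1 + r), ← hC2 (n + 1 + r), ← hTdot r]; ring
  rw [← hmul, hzero, mul_zero]

/-- ★★★ **Third contact annihilator of `S₂`**: `Σ t_rĈ³(n+1+r) + 3Σ ṫ_rĈ²(n+1+r) + 3Σ ṫ_rĈ(n+1+r) + Σ ṫ_rD̂(n+1+r) = 0` (`y > 0`).
[cite: Feller1968, XIII.6; lane «pcv-sawmu» a-p2 g29 — own result] -/
theorem detYTwo_contact_cube_annihilator {y : ℝ} (hy : 0 < y) (a b : Fin (2 * 2)) (n : ℕ) :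
    ∑ r ∈ range 5, detYTwo y r * hatC3DTwo y (n + 1 + r) a b + 3 * ∑ r ∈ range 5, detYTwoDot y r * hatC2D y (n + 1 + r) a b
      + 3 * ∑ r ∈ range 5, detYTwoDot y r * hatCD y (n + 1 + r) a b + ∑ r ∈ range 5, detYTwoDot y r * hatD 2 y (n + 1 + r) a b = 0 := by
  set dU : ℕ → ℝ → ℝ := fun k y =>
    ∑ l ∈ LUset 2 (2 * k + 1) (hatLen k a b) (a : ℕ) (b : ℕ), hexCriticalFugacity ^ (l.length - 1) * ((topCnt 2 l.tail : ℝ) * y ^ (topCnt 2 l.tail - 1))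
    with hdU
  set dC : ℕ → ℝ → ℝ := fun k y =>
    ∑ l ∈ LUset 2 (2 * k + 1) (hatLen k a b) (a : ℕ) (b : ℕ),
      (topCnt 2 l.tail : ℝ) * (hexCriticalFugacity ^ (l.length - 1) * ((topCnt 2 l.tail : ℝ) * y ^ (topCnt 2 l.tail - 1))) with hdC
  set dC2 : ℕ → ℝ → ℝ := fun k y =>
    ∑ l ∈ LUset 2 (2 * k + 1) (hatLen k a b) (a : ℕ) (b : ℕ),
      (topCnt 2 l.tail : ℝ) ^ 2 * (hexCriticalFugacity ^ (l.length - 1) * ((topCnt 2 l.tail : ℝ) * y ^ (topCnt 2 l.tail - 1))) with hdC2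
  have hD : ∀ k (y : ℝ), HasDerivAt (fun y => hatD 2 y k a b) (dU k y) y := fun k y => hasDerivAt_LUs (2 * k + 1) (hatLen k a b) _ _ y
  have hC : ∀ k (y : ℝ), HasDerivAt (fun y => hatCD y k a b) (dC k y) y := fun k y => by
    simp only [hatCD, Matrix.of_apply]; exact hasDerivAt_contactSum _ y
  have hC2d : ∀ k (y : ℝ), HasDerivAt (fun y => hatC2D y k a b) (dC2 k y) y := fun k y => by
    simp only [hatC2D, Matrix.of_apply]; exact hasDerivAt_contactSqSum_two _ y
  have hU : ∀ k, y * dU k y = hatCD y k a b := fun k => by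
    rw [hdU]; simp only [hatCD, Matrix.of_apply]; exact mul_derivSum_eq_contactSum _ y
  have hC2 : ∀ k, y * dC k y = hatC2D y k a b := fun k => by
    rw [hdC]; simp only [hatC2D, Matrix.of_apply]; exact mul_derivContactSum_eq _ y
  have hC3 : ∀ k, y * dC2 k y = hatC3DTwo y k a b := fun k => by
    rw [hdC2]; simp only [hatC3DTwo, Matrix.of_apply]; exact mul_derivContactSqSum_two_eq _ y
  choose dT hdT hTdot using fun r => hasDerivAt_detYTwo y r
  choose dTd hdTd hTddot using fun r => hasDerivAt_detYTwoDot y r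
  have hdd : ∀ r, dTd r = dT r := fun r => mul_left_cancel₀ hy.ne' ((hTddot r).trans (hTdot r).symm)
  set F : ℝ → ℝ := fun y => ∑ r ∈ range 5, detYTwo y r * hatC2D y (n + 1 + r) a b + 2 * ∑ r ∈ range 5, detYTwoDot y r * hatCD y (n + 1 + r) a b
      + ∑ r ∈ range 5, detYTwoDot y r * hatD 2 y (n + 1 + r) a b with hF
  have hFd : HasDerivAt F (∑ r ∈ range 5, (dT r * hatC2D y (n + 1 + r) a b + detYTwo y r * dC2 (n + 1 + r) y)
      + 2 * ∑ r ∈ range 5, (dTd r * hatCD y (n + 1 + r) a b + detYTwoDot y r * dC (n + 1 + r) y)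
      + ∑ r ∈ range 5, (dTd r * hatD 2 y (n + 1 + r) a b + detYTwoDot y r * dU (n + 1 + r) y)) y := by
    rw [hF]
    exact ((HasDerivAt.fun_sum fun r _ => (hdT r).mul (hC2d (n + 1 + r) y)).add
      ((HasDerivAt.fun_sum fun r _ => (hdTd r).mul (hC (n + 1 + r) y)).const_mul 2)).add
      (HasDerivAt.fun_sum fun r _ => (hdTd r).mul (hD (n + 1 + r) y))
  have hF0 : F =ᶠ[𝓝 y] fun _ => (0 : ℝ) := by
    filter_upwards [Ioi_mem_nhds hy] with y' hy'
    rw [hF]; exact detYTwo_contact_sq_annihilator hy' a b n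
  have hzero := (hFd.congr_of_eventuallyEq hF0.symm).unique (hasDerivAt_const y (0 : ℝ))
  have hmul : y * (∑ r ∈ range 5, (dT r * hatC2D y (n + 1 + r) a b + detYTwo y r * dC2 (n + 1 + r) y)
      + 2 * ∑ r ∈ range 5, (dTd r * hatCD y (n + 1 + r) a b + detYTwoDot y r * dC (n + 1 + r) y)
      + ∑ r ∈ range 5, (dTd r * hatD 2 y (n + 1 + r) a b + detYTwoDot y r * dU (n + 1 + r) y))
      = ∑ r ∈ range 5, detYTwo y r * hatC3DTwo y (n + 1 + r) a b + 3 * ∑ r ∈ range 5, detYTwoDot y r * hatC2D y (n + 1 + r) a b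
        + 3 * ∑ r ∈ range 5, detYTwoDot y r * hatCD y (n + 1 + r) a b + ∑ r ∈ range 5, detYTwoDot y r * hatD 2 y (n + 1 + r) a b := by
    rw [mul_add, mul_add, ← mul_assoc y 2, mul_comm y 2, mul_assoc 2 y, Finset.mul_sum, Finset.mul_sum, Finset.mul_sum, Finset.mul_sum,
      Finset.mul_sum, Finset.mul_sum, ← Finset.sum_add_distrib, ← Finset.sum_add_distrib, ← Finset.sum_add_distrib, ← Finset.sum_add_distrib,
      ← Finset.sum_add_distrib]
    refine Finset.sum_congr rfl fun r _ => ?_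
    rw [hdd r, ← hU (n + 1 + r), ← hC2 (n + 1 + r), ← hC3 (n + 1 + r), ← hTdot r]; ring
  rw [← hmul, hzero, mul_zero]

/-! ## §4 Plumbing for the moment laws -/

/-- `((n+r)+1)^k R^{n+r} ≤ (r+1)^k·(n+1)^k·Rⁿ` for `0 ≤ R ≤ 1` (plumbing; twin of the width-three lemma). [cite: Stanley2012EC1, §4.1; lane plumbing] -/
private theorem succ_add_pow_mul_pow_le_two {R : ℝ} (hR0 : 0 ≤ R) (hR1 : R ≤ 1) (n r k : ℕ) :
    (((n + r : ℕ) : ℝ) + 1) ^ k * R ^ (n + r) ≤ ((r : ℝ) + 1) ^ k * (((n : ℝ) + 1) ^ k * R ^ n) := by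
  have hn : (0 : ℝ) ≤ (n : ℝ) := Nat.cast_nonneg n
  have hr : (0 : ℝ) ≤ (r : ℝ) := Nat.cast_nonneg r
  have hle : ((n + r : ℕ) : ℝ) + 1 ≤ ((r : ℝ) + 1) * ((n : ℝ) + 1) := by rw [Nat.cast_add]; nlinarith [mul_nonneg hn hr]
  have hpow : (((n + r : ℕ) : ℝ) + 1) ^ k ≤ (((r : ℝ) + 1) * ((n : ℝ) + 1)) ^ k := pow_le_pow_left₀ (by positivity) hle k
  have hRle : R ^ (n + r) ≤ R ^ n := by rw [pow_add]; exact mul_le_of_le_one_right (pow_nonneg hR0 n) (pow_le_one₀ hR0 hR1)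
  calc (((n + r : ℕ) : ℝ) + 1) ^ k * R ^ (n + r) ≤ (((r : ℝ) + 1) * ((n : ℝ) + 1)) ^ k * R ^ n :=
        mul_le_mul hpow hRle (pow_nonneg hR0 _) (by positivity)
    _ = ((r : ℝ) + 1) ^ k * (((n : ℝ) + 1) ^ k * R ^ n) := by rw [mul_pow]; ring

/-- A finite sum of shifted errors over `range 5` (plumbing; the width-three file has the `range 25` twin). [cite: Stanley2012EC1, §4.1; lane plumbing] -/
theorem abs_sum_mul_shift_le_five {g e : ℕ → ℝ} {K R : ℝ} {k : ℕ} (hR0 : 0 ≤ R) (hR1 : R ≤ 1) (hK : 0 ≤ K)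
    (he : ∀ m : ℕ, |e m| ≤ K * ((m : ℝ) + 1) ^ k * R ^ m) (n : ℕ) :
    |∑ r ∈ range 5, g r * e (n + r)| ≤ (K * ∑ r ∈ range 5, |g r| * ((r : ℝ) + 1) ^ k) * (((n : ℝ) + 1) ^ k * R ^ n) := by
  calc |∑ r ∈ range 5, g r * e (n + r)| ≤ ∑ r ∈ range 5, |g r * e (n + r)| := Finset.abs_sum_le_sum_abs _ _
    _ ≤ ∑ r ∈ range 5, |g r| * (K * ((r : ℝ) + 1) ^ k * (((n : ℝ) + 1) ^ k * R ^ n)) := by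
        refine Finset.sum_le_sum fun r _ => ?_
        rw [abs_mul]
        refine mul_le_mul_of_nonneg_left ?_ (abs_nonneg _)
        calc |e (n + r)| ≤ K * (((n + r : ℕ) : ℝ) + 1) ^ k * R ^ (n + r) := he (n + r)
          _ = K * ((((n + r : ℕ) : ℝ) + 1) ^ k * R ^ (n + r)) := by ring
          _ ≤ K * (((r : ℝ) + 1) ^ k * (((n : ℝ) + 1) ^ k * R ^ n)) := mul_le_mul_of_nonneg_left (succ_add_pow_mul_pow_le_two hR0 hR1 n r k) hK
          _ = K * ((r : ℝ) + 1) ^ k * (((n : ℝ) + 1) ^ k * R ^ n) := by ring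
    _ = (K * ∑ r ∈ range 5, |g r| * ((r : ℝ) + 1) ^ k) * (((n : ℝ) + 1) ^ k * R ^ n) := by
        rw [Finset.mul_sum, Finset.sum_mul]; exact Finset.sum_congr rfl fun r _ => by ring


end W2

end HV

end Literature.Probability.RandomPlanarGeometry.SAW
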